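/-
Copyright: lit-balaban Phase-2 proof seat p33 (gen 8).  Statement-level skeleton of a published paper; no proof claims beyond what
the kernel checks below.
-/
import Literature.MathematicalPhysics.QuantumFieldTheory.BalabanImbrieJaffe1984to88.BIJ85ResidualSupBound
import Literature.MathematicalPhysics.QuantumFieldTheory.BalabanImbrieJaffe1984to88.BIJ85Ineq722AllTori
import Literature.MathematicalPhysics.QuantumFieldTheory.BalabanImbrieJaffe1984to88.BIJ85Prop12AllTori

/-!
# [BalabanImbrieJaffe1985] §7.3: ONE residual constant `K_R` for ALL TORI — (7.3.1) ⇒ (7.3.2) uniformly in the scale AND in the volume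

T. Bałaban, J. Imbrie, A. Jaffe, *Renormalization of the Higgs model: minimizers, propagators and the stability of mean field theory*,
Commun. Math. Phys. **97** (1985) 299–329 [BalabanImbrieJaffe1985].  Row **C1.Eq7.3.1-7.3.2** of the lit-balaban skeleton (owner r15),
the ALL-TORI form of its load-bearing chain.

statement-level skeleton of published theorems with citation tags; proofs where landed; nothing here is a claim about the Yang–Mills mass gap

PDF held: `paper:balaban1985-cmp97-bij-higgs-minimizers` (p. 326 = PDF 28; p. 325 = PDF 27).

THE PRINTED TEXT, verbatim, p. 326 [PDF 28]: *"Then the stability estimate can be stated in two forms. For constants γ > 0, α > 0, M < ∞,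
⟨φ, Δ_k(u_k)φ⟩ ≥ γΣ_{b∈T₁^{(k)}}|u_k(b)φ(b₊) − φ(b₋)|² − Me_k^{2−α}Σ_{x∈T₁^{(k)}}|φ(x)|². (7.3.2) … These bounds follow from (7.2.2–4)."*, and
p. 325 [PDF 27] on the constants of (7.2.2): *"This inequality is a consequence of Proposition 1.2 and the representation (1.103) of [6I]"*,
[6I] p. 35 *"with the constant O(1) depending on d only"*, p. 33 *"independent of k, T_η"* — the printed constants `γ, α, M` are chosen
BEFORE the torus: uniform in the scale `k` AND in the volume `T_η`.

WHAT THIS FILE ADDS (theorems only; no `def`, no new named fact; nothing restated).  The tree has the chain for ONE torus `P`: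
p30's `BIJ85ResidualSupBound.closedIdx_total_of_ineq722` gives one `K_R` for all scales of `P` from r15's typed (7.2.2) for p09's
per-tower kernel family, and gen-7's `BIJ85Claim73Closed.claim73_closed` is r15's `Claim73 𝓅` over `ClosedIdx d K_R 𝓅`.  The typing note
G-C1-07 (p16, `BIJ85Prop12PerTower`) observed that per-tower `∃`-encodings are true by finiteness; the content-bearing statement is the
ALL-TORI one.  Here:
* §1 `exists_gradH_bound_seq_of_ineq722` — the `∇H` member of the typed (7.2.2) `KernelData.Ineq722` read at `α = 0` for ANY SEQUENCE
  `n ↦ (P_n, k_n)` of tori and scales (the sequence form of p08's `BIJ88Ineq217Ineq722Torus.exists_bound_of_ineq722`).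
* §2 `abs_resE_le_of_closed_gradH` — one torus of dimension `d`, one scale: the gradient kernel bound `|∇H_{k,μν}(x,y)| ≤ M₀e^{−δ|x−y|}`
  gives, for every CLOSED unit field `f` with `|f| ≤ s`, `|f_k(p)| = |resE(f)(p)| ≤ K(d, M₀, δ)·√(η^d)·s` with
  `K(d, M₀, δ) = 1 + (8d+2)·2M₀e^{δ/2}·(1 + 4d/δ)²·d·(2(1 + 2d/δ))^d` — p08's `hK_of_kernelBounds` ∘ p30's `abs_resE_le_of_closed_eta`, the
  dimension made an explicit parameter so that the constant is visibly the same for every torus of dimension `d`.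
* §3 **`exists_KR_seq_of_ineq722`** — ONE `K_R ≥ 1` along any sequence of tori/scales with `KernelData.Ineq722`; **`closedIdx_seq_of_ineq722`** —
  every actual datum along the sequence is an index of gen-7's `ClosedIdx d K_R 𝓅`.
* §4 **`exists_KR_allTori_of_prop12Printed`** — GIVEN ONLY [6I] Proposition 1.2 by its tree name `B5.Prop12Printed` over the ALL-TORI family
  of p09's carriers (p16's subtype index `{(P, k) // P.d = d ∧ P.L = L ∧ 1 ≤ k ≤ m + K}`, `BIJ85Ineq722AllTori`): ONE `K_R ≥ 1` such that for
  EVERY torus `P` with `P.d = d`, `P.L = L`, every scale `1 ≤ k ≤ m + K`, every closed unit field `f` with `|f| ≤ s` and every η-plaquette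
  `p`, `|resE(f)(p)| ≤ K_R·√(η^d)·s` (a countable enumeration of the index inside the proof feeds p16's `ineq722_deltaA_seq_of_prop12Printed`
  and §3).
* §5 **`closedIdx_allTori_of_prop12Printed`** / **`claim73_allTori_of_prop12Printed`** — at that ONE `K_R`, EVERY actual Sect. 7.3 datum over
  EVERY torus of dimension `d` and block size `L` (any volume `m`, any number of steps `K`, any scale `1 ≤ k ≤ m + K`, any coupling
  `0 < e_k ≤ 1` with `e_k𝓅(e_k) ≤ ½`, any unit field `v`) is an index of `ClosedIdx d K_R 𝓅`, so gen-7's `claim73_closed` — r15's `Claim73 𝓅`: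
  constants `γ = min(a₀/(9(d+1)), 1/12)`, `α = ½`, `M = (4/3)d⁴((π/2)K_R)²(1+4𝓅₊)^{2𝓅₊}` chosen once — is (7.3.1) ⇒ (7.3.2) for the ACTUAL
  background (4.5.4) UNIFORMLY IN `k` AND IN THE VOLUME, given Prop. 1.2 over all tori only.
* §6 (v1.1) **`exists_KR_allTori`** / **`closedIdx_allTori`** / **`claim73_allTori`** — §4–§5 HYPOTHESIS-FREE: the all-tori `B5.Prop12Printed`
  hypothesis `h12` is p19's `BIJ85Prop12AllTori.prop12Printed_allTori d L ha` ([6I] Prop. 1.2 by its tree name over all tori, exported from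
  `B5Prop12GHolds.prop12_famG_printed` through the p09 ↔ r02 encoding bridge), so ONE `K_R(d, L, a) ≥ 1` and r15's `Claim73 𝓅` over
  `ClosedIdx d K_R 𝓅` ∋ every actual datum of every torus of dimension `d ≥ 2` and block size `L` hold with NO hypothesis beyond `2 ≤ d`,
  `0 < a`, `0 < a₀`.
HONEST SCOPE.  (i) §4–§5 keep the all-tori `B5.Prop12Printed` as a named hypothesis (the statements of record of v1.0); §6 discharges it by
p19's `prop12Printed_allTori` (G-C1-07 closed on the all-tori index); §3 takes the typed (7.2.2) along a sequence instead.  (ii) First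
printed form of (7.3.2); CLOSED unit fields (necessarily: `BIJ85ResidualNonClosed`); `U = 1` real abelian fields; torus; standing range
`k ≤ m + K`; constants explicit, not optimised; `2 ≤ d`.  (iii) Nothing here is summit progress.  Unit `lit-balaban-p33`
(literature-prover-lit-balaban-p33-g8-0), HOME `run/shared/lean/pub/lit-balaban/`, 2026-08-21.
-/

open scoped BigOperators RealInnerProductSpace

namespace Literature.MathematicalPhysics.QuantumFieldTheory.BalabanImbrieJaffe1984to88.BIJ85Claim73AllTori

open Balaban1983to89 hiding Site Plaq
open Balaban1983to89.LatticeFieldCalculus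
open BIJ85AxialPropagator411 BIJ85Prop521Torus BIJ85Sigma421Torus BIJ85Eq611Torus BIJ85Prop522Torus BIJ85Sigma422Eta
open BIJ85Sect7Statements BIJ85Ineq722Torus
open BIJ85Ineq722ProofPart2 (settingOf)
open BIJ85Ineq722DeltaA (deltaAData)
open BIJ85Ineq722AllTori (ineq722_deltaA_seq_of_prop12Printed)
open BIJ85Prop12AllTori (prop12Printed_allTori)
open BIJ85Eq454PlaqResidual (resE)
open BIJ85GaugeFunction5113 (blk)
open BIJ88Ineq217Ineq722Torus (hK_of_kernelBounds torusKernelData_distEta torusKernelData_distEU torusKernelData_gradH_nonneg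
  torusKernelData_gradHDiff_nonneg)
open BIJ85UnitTorusHodge (plaqCoch IsClosedPlaq)
open BIJ85Sect1Model (U1Field)
open BIJ85Claim73Closed (altExt ClosedIdx closedStabData claim73_closed)
open BIJ85ResidualSupBound (abs_resE_le_of_closed_eta altExt_eq_plaqCoch nonneg_of_abs_le)
open B5Positivity172Lattice (chart)
-- inside this namespace the bare `Site`/`Plaq` are the `ℤ^d` carriers of the QFT root; the torus ones are renamed:
open Balaban1983to89 renaming Site → TSite, Plaq → TPlaq

noncomputable section

/-! ## §0  Torus bookkeeping -/

/-- `x + e_μ ≠ x` on every torus of the series (`1 ≠ 0` in `ZMod (2L^{m+K−j})`). [folklore] -/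
private theorem shift_ne_self {P : Params} {j : ℕ} (x : TSite P j) (μ : Fin P.d) : x.shift μ ≠ x := by
  intro h
  have h1 := congrFun h μ
  simp only [Balaban1983to89.Site.shift, Function.update_self] at h1
  exact one_ne_zero (add_eq_left.1 h1)

/-- `|x − (x + e_μ)|_∞ ≤ 1`. [folklore] -/
private theorem supDist_shift_le {P : Params} {j : ℕ} (x : TSite P j) (μ : Fin P.d) : supDist x (x.shift μ) ≤ 1 := by
  have h := supDist_runSite_le x μ 1
  have h2 : runSite x μ 1 = x.shift μ := by
    show Function.update x μ (x μ + ((1 : ℕ) : ZMod _)) = Function.update x μ (x μ + 1)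
    rw [Nat.cast_one]
  rwa [h2] at h

/-- `Params` is countable (four natural numbers and two proofs). [folklore] -/
private theorem countable_params : Countable Params := by
  refine Function.Injective.countable (f := fun P : Params => (P.d, P.L, P.m, P.K)) ?_
  intro P Q h
  obtain ⟨d, L, m, K, hd, hL⟩ := P
  obtain ⟨d', L', m', K', hd', hL'⟩ := Q
  simp only [Prod.mk.injEq] at h
  obtain ⟨rfl, rfl, rfl, rfl⟩ := h
  rfl

/-! ## §1  The `∇H` member of the typed (7.2.2) along a sequence of tori -/

/-- **(7.2.2) along ANY SEQUENCE of tori and scales, the `|∇H|` member at `α = 0`**: from r15's typed display `KernelData.Ineq722` for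
the family `n ↦ torusKernelData (P_n) (k_n) (deltaAData …) …` (p09's carriers, p16's all-tori indexing): `∃ δ > 0, M₀ ≥ 0` with
`|∇H_{k_n,μν}(x, y)| ≤ M₀e^{−δ|x − y|}` on EVERY torus `P_n` of the sequence — the side condition `|x − x′| ≤ 1`, `x ≠ x′` met by
`x′ = x + ηe_μ`, the `|H|` and Hölder members dropped (`≥ 0`). [cite: BalabanImbrieJaffe1985, (7.2.2) p.325] -/
theorem exists_gradH_bound_seq_of_ineq722 (Pn : ℕ → Params) (kn : ℕ → ℕ) (hkn : ∀ n, kn n ≤ (Pn n).m + (Pn n).K) {a : ℝ}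
    {BondU : ℕ → Type} {distEB : (n : ℕ) → TSite (Pn n) 0 → BondU n → ℝ}
    {Cker : (n : ℕ) → Fin (Pn n).d → Fin (Pn n).d → TSite (Pn n) (kn n) → TSite (Pn n) (kn n) → ℝ}
    {Dker : (n : ℕ) → TSite (Pn n) 0 → BondU n → ℝ}
    (h722 : KernelData.Ineq722
      (fun n => torusKernelData (Pn n) (kn n) (deltaAData (hkn n) a) (BondU n) (distEB n) (Cker n) (Dker n))) :
    ∃ δ M₀ : ℝ, 0 < δ ∧ 0 ≤ M₀ ∧ ∀ (n : ℕ) (μ ν : Fin (Pn n).d) (x : TSite (Pn n) 0) (y : TSite (Pn n) (kn n)),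
      (torusKernelData (Pn n) (kn n) (deltaAData (hkn n) a) (BondU n) (distEB n) (Cker n) (Dker n)).gradH μ ν x y ≤
        M₀ * Real.exp (-(δ * distEU (Pn n) (kn n) x y)) := by
  obtain ⟨δ, hδ, hα⟩ := h722
  obtain ⟨M, hM⟩ := hα 0 le_rfl zero_lt_one
  have key : ∀ (n : ℕ) (μ ν : Fin (Pn n).d) (x : TSite (Pn n) 0) (y : TSite (Pn n) (kn n)),
      (torusKernelData (Pn n) (kn n) (deltaAData (hkn n) a) (BondU n) (distEB n) (Cker n) (Dker n)).gradH μ ν x y ≤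
        M * Real.exp (-(δ * distEU (Pn n) (kn n) x y)) := by
    intro n μ ν x y
    have hL1 : (1 : ℝ) ≤ ((Pn n).L : ℝ) := by exact_mod_cast (Pn n).L_pos
    have hne : x ≠ x.shift μ := (shift_ne_self x μ).symm
    have hle : (torusKernelData (Pn n) (kn n) (deltaAData (hkn n) a) (BondU n) (distEB n) (Cker n) (Dker n)).distEta
        x (x.shift μ) ≤ 1 := by
      rw [torusKernelData_distEta, dS_le_iff, one_mul]
      have h1 : (supDist x (x.shift μ) : ℝ) ≤ 1 := by exact_mod_cast supDist_shift_le x μ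
      exact h1.trans (one_le_pow₀ hL1)
    have h := hM n μ ν x (x.shift μ) y hne hle
    rw [neg_zero, Real.rpow_zero, one_mul, torusKernelData_distEU] at h
    exact ((le_add_of_nonneg_left (abs_nonneg _)).trans (le_add_of_nonneg_right torusKernelData_gradHDiff_nonneg)).trans h
  have hM0 : 0 ≤ M :=
    (mul_nonneg_iff_of_pos_right (Real.exp_pos _)).1
      (le_trans torusKernelData_gradH_nonneg (key 0 ⟨0, (Pn 0).hd⟩ ⟨0, (Pn 0).hd⟩ default default))
  exact ⟨δ, M, hδ, hM0, key⟩

/-! ## §2  One torus of dimension `d`: the closed-field residual bound from the gradient kernel bound -/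

/-- **THE RESIDUAL OF A CLOSED UNIT FIELD, ONE TORUS OF DIMENSION `d`, ONE SCALE** (`k ≤ m + K`, `2 ≤ d`, `G_k = Δ_a⁻¹`, `a > 0`): if the
gradient kernel of the representation (1.103) obeys `|∇H_{k,μν}(x, y)| ≤ M₀e^{−δ|x−y|}` (`M₀ ≥ 0`, `δ > 0`), then for every CLOSED unit
plaquette field `f` with `|f(q)| ≤ s` and every η-plaquette `p`,
`|resE(f)(p)| ≤ (1 + (8d+2)·2M₀e^{δ/2}·(1 + 4/(δ/d))²·d·(2(1 + (δ/d/2)⁻¹))^d)·√(η^d)·s` — p08's `hK_of_kernelBounds` (∂^{η⁻¹}H_k from ∇H,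
rate `δ/d` in the `ℓ¹` block distance) feeding p30's `abs_resE_le_of_closed_eta` (flux part exactly, curl part in the gauge of p. 326);
the constant depends on `(d, M₀, δ)` only. [cite: BalabanImbrieJaffe1985, (7.3.2) p.326] -/
theorem abs_resE_le_of_closed_gradH {d : ℕ} (hd : 2 ≤ d) {P : Params} (hPd : P.d = d) {k : ℕ} (hk : k ≤ P.m + P.K) {a : ℝ}
    (ha : 0 < a) {BondU : Type} {distEB : TSite P 0 → BondU → ℝ} {Cker : Fin P.d → Fin P.d → TSite P k → TSite P k → ℝ}
    {Dker : TSite P 0 → BondU → ℝ} {δ M₀ : ℝ} (hδ : 0 < δ) (hM₀ : 0 ≤ M₀)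
    (hB : ∀ (μ ν : Fin P.d) (x : TSite P 0) (y : TSite P k),
      (torusKernelData P k (deltaAData hk a) BondU distEB Cker Dker).gradH μ ν x y ≤ M₀ * Real.exp (-(δ * distEU P k x y)))
    {f : TPlaq P k → ℝ} (hf : IsClosedPlaq f) {s : ℝ} (hs0 : 0 ≤ s) (hs : ∀ q, |f q| ≤ s) (p : TPlaq P 0) :
    |resE (hd.trans_eq hPd.symm) ((P.eta k) ^ P.d) (P.eta k)⁻¹ k (toU P k f) p| ≤
      (1 + (8 * d + 2) * (2 * M₀ * Real.exp (δ / 2)) *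
          ((1 + 4 / (δ / d)) ^ 2 * ((d : ℝ) * (2 * (1 + (δ / d / 2)⁻¹)) ^ d))) *
        Real.sqrt ((P.eta k) ^ P.d) * s := by
  subst hPd
  have hd0 : (0 : ℝ) < (P.d : ℝ) := by exact_mod_cast P.hd
  exact abs_resE_le_of_closed_eta hd hk (by positivity) (div_pos hδ hd0)
    (fun p b => hK_of_kernelBounds hk (pow_ne_zero _ P.cast_L_pos.ne') (pow_pos (eta_pos P k) _) ha hδ.le hM₀ hB p b)
    hf hs0 hs p

/-! ## §3  One `K_R` along any sequence of tori, from the typed (7.2.2) -/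

/-- **ONE `K_R` ALONG ANY SEQUENCE OF TORI AND SCALES, from the typed row C1.Eq7.2.1-7.2.2**: for `n ↦ (P_n, k_n)` with all `P_n.d = d`
(`2 ≤ d`), `k_n ≤ m_n + K_n`, `G = Δ_a⁻¹` (`a > 0`), r15's `KernelData.Ineq722` for the sequence family of p09's carriers gives ONE `K_R ≥ 1`
such that on EVERY torus `P_n` of the sequence, for every CLOSED unit plaquette field `f` on `T^{(k_n)}` with `|f| ≤ s` and every η-plaquette
`p`: `|resE(f)(p)| ≤ K_R·√(η^d)·s` — the located input of the residual route to (7.3.2), uniform along the sequence (in `k` AND in the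
volume). [cite: BalabanImbrieJaffe1985, (7.3.2) p.326] -/
theorem exists_KR_seq_of_ineq722 {d : ℕ} (hd : 2 ≤ d) (Pn : ℕ → Params) (hPd : ∀ n, (Pn n).d = d) (kn : ℕ → ℕ)
    (hkn : ∀ n, kn n ≤ (Pn n).m + (Pn n).K) {a : ℝ} (ha : 0 < a)
    {BondU : ℕ → Type} {distEB : (n : ℕ) → TSite (Pn n) 0 → BondU n → ℝ}
    {Cker : (n : ℕ) → Fin (Pn n).d → Fin (Pn n).d → TSite (Pn n) (kn n) → TSite (Pn n) (kn n) → ℝ}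
    {Dker : (n : ℕ) → TSite (Pn n) 0 → BondU n → ℝ}
    (h722 : KernelData.Ineq722
      (fun n => torusKernelData (Pn n) (kn n) (deltaAData (hkn n) a) (BondU n) (distEB n) (Cker n) (Dker n))) :
    ∃ KR : ℝ, 1 ≤ KR ∧ ∀ (n : ℕ) (f : TPlaq (Pn n) (kn n) → ℝ), IsClosedPlaq f → ∀ (s : ℝ), 0 ≤ s → (∀ q, |f q| ≤ s) →
      ∀ p : TPlaq (Pn n) 0,
        |resE (hd.trans_eq (hPd n).symm) (((Pn n).eta (kn n)) ^ (Pn n).d) ((Pn n).eta (kn n))⁻¹ (kn n) (toU (Pn n) (kn n) f) p| ≤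
          KR * Real.sqrt (((Pn n).eta (kn n)) ^ (Pn n).d) * s := by
  obtain ⟨δ, M₀, hδ, hM₀, hB⟩ := exists_gradH_bound_seq_of_ineq722 Pn kn hkn h722
  refine ⟨1 + (8 * d + 2) * (2 * M₀ * Real.exp (δ / 2)) *
      ((1 + 4 / (δ / d)) ^ 2 * ((d : ℝ) * (2 * (1 + (δ / d / 2)⁻¹)) ^ d)),
    le_add_of_nonneg_right (by positivity), ?_⟩
  intro n f hf s hs0 hs p
  exact abs_resE_le_of_closed_gradH hd (hPd n) (hkn n) ha hδ hM₀ (hB n) hf hs0 hs p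

/-- **EVERY ACTUAL DATUM ALONG THE SEQUENCE IS AN INDEX OF gen-7's `ClosedIdx d K_R 𝓅` AT THAT ONE `K_R`**: for every `n` with `1 ≤ k_n`,
every coupling `0 < e ≤ 1` with `e𝓅(e) ≤ ½` and EVERY unit-lattice `U(1)` field `v` on `T^{(k_n)}` of the torus `P_n`, the datum
`(P_n, k_n, e, v)` is an index of `BIJ85Claim73Closed.ClosedIdx d K_R 𝓅` (built with `ClosedIdx.ofD₂`) — so `claim73_closed` covers all of
them with constants chosen once for the sequence. [cite: BalabanImbrieJaffe1985, (7.3.2) p.326] -/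
theorem closedIdx_seq_of_ineq722 {d : ℕ} (hd : 2 ≤ d) (Pn : ℕ → Params) (hPd : ∀ n, (Pn n).d = d) (kn : ℕ → ℕ)
    (hkn : ∀ n, kn n ≤ (Pn n).m + (Pn n).K) {a : ℝ} (ha : 0 < a)
    {BondU : ℕ → Type} {distEB : (n : ℕ) → TSite (Pn n) 0 → BondU n → ℝ}
    {Cker : (n : ℕ) → Fin (Pn n).d → Fin (Pn n).d → TSite (Pn n) (kn n) → TSite (Pn n) (kn n) → ℝ}
    {Dker : (n : ℕ) → TSite (Pn n) 0 → BondU n → ℝ}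
    (h722 : KernelData.Ineq722
      (fun n => torusKernelData (Pn n) (kn n) (deltaAData (hkn n) a) (BondU n) (distEB n) (Cker n) (Dker n))) (pexp : ℝ) :
    ∃ KR : ℝ, 1 ≤ KR ∧ ∀ (n : ℕ), 1 ≤ kn n → ∀ (e : ℝ) (he : 0 < e) (he1 : e ≤ 1)
      (hsmall : e * (1 + Real.log e⁻¹) ^ pexp ≤ 1 / 2) (v : U1Field (Pn n) (kn n)),
      ∃ i : ClosedIdx d KR pexp, i.P = Pn n ∧ i.k = kn n ∧ i.e = e ∧ HEq i.v v := by
  obtain ⟨KR, hKR, hb⟩ := exists_KR_seq_of_ineq722 hd Pn hPd kn hkn ha h722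
  refine ⟨KR, hKR, fun n hk1 e he he1 hsmall v => ?_⟩
  refine ⟨ClosedIdx.ofD₂ (Pn n) (hPd n) (hd.trans_eq (hPd n).symm) (kn n) hk1 (hkn n) e he he1 hsmall v ?_,
    rfl, rfl, rfl, HEq.rfl⟩
  intro F hF s hs p
  have hcl : IsClosedPlaq F := by rw [altExt_eq_plaqCoch] at hF; exact hF
  rw [mul_comm (Real.sqrt _) KR]
  exact hb n F hcl s (nonneg_of_abs_le (hd.trans_eq (hPd n).symm) hs) hs p

/-! ## §4  ALL TORI: one `K_R` given [6I] Proposition 1.2 by its tree name over the all-tori family -/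

/-- **ONE `K_R` FOR ALL TORI, GIVEN ONLY [6I] PROPOSITION 1.2 BY ITS TREE NAME OVER ALL TORI**: if `B5.Prop12Printed` holds for p09's
carriers indexed by ALL pairs `(P, k)` with `P.d = d`, `P.L = L`, `1 ≤ k ≤ m + K` (constants before the torus — p16's faithful reading of
[6I] *"depending on d only … independent of k, T_η"*), then there is ONE `K_R ≥ 1` such that for EVERY torus `P` of dimension `d ≥ 2` and
block size `L` (any volume, any number of steps), every scale `1 ≤ k ≤ m + K`, every CLOSED unit plaquette field `f` on `T^{(k)}` with
`|f| ≤ s` and every η-plaquette `p`: `|resE(f)(p)| ≤ K_R·√(η^d)·s`.  Proof: the index is countable; along an enumeration p16's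
`ineq722_deltaA_seq_of_prop12Printed` gives (7.2.2) with one `δ`, one `M(α)`, and §3 applies. [cite: BalabanImbrieJaffe1985, (7.3.2) p.326] -/
theorem exists_KR_allTori_of_prop12Printed {d L : ℕ} (hd : 2 ≤ d) {a : ℝ} (ha : 0 < a)
    (h12 : B5.Prop12Printed (fun i : {x : Params × ℕ // x.1.d = d ∧ x.1.L = L ∧ 1 ≤ x.2 ∧ x.2 ≤ x.1.m + x.1.K} =>
      settingOf (torusRep i.1.1 i.1.2 (deltaAData i.2.2.2.2 a)) i.1.2)) :
    ∃ KR : ℝ, 1 ≤ KR ∧ ∀ (P : Params) (hPd : P.d = d), P.L = L → ∀ (k : ℕ), 1 ≤ k → k ≤ P.m + P.K →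
      ∀ (f : TPlaq P k → ℝ), IsClosedPlaq f → ∀ (s : ℝ), 0 ≤ s → (∀ q, |f q| ≤ s) → ∀ p : TPlaq P 0,
        |resE (hd.trans_eq hPd.symm) ((P.eta k) ^ P.d) (P.eta k)⁻¹ k (toU P k f) p| ≤ KR * Real.sqrt ((P.eta k) ^ P.d) * s := by
  haveI : Countable Params := countable_params
  rcases isEmpty_or_nonempty {x : Params × ℕ // x.1.d = d ∧ x.1.L = L ∧ 1 ≤ x.2 ∧ x.2 ≤ x.1.m + x.1.K} with hI | hI
  · refine ⟨1, le_rfl, fun P hPd hPL k hk1 hk => ?_⟩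
    exact (hI.false ⟨(P, k), hPd, hPL, hk1, hk⟩).elim
  obtain ⟨g, hg⟩ := exists_surjective_nat {x : Params × ℕ // x.1.d = d ∧ x.1.L = L ∧ 1 ≤ x.2 ∧ x.2 ≤ x.1.m + x.1.K}
  have h722 := ineq722_deltaA_seq_of_prop12Printed ha h12 (fun n => (g n).1.1) (fun n => (g n).2.1) (fun n => (g n).2.2.1)
    (fun n => (g n).1.2) (fun n => (g n).2.2.2.1) (fun n => (g n).2.2.2.2) (fun _ => PUnit) (fun _ _ _ => 0)
    (fun _ _ _ _ _ => 0) (fun _ _ _ => 0)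
  obtain ⟨KR, hKR, hb⟩ := exists_KR_seq_of_ineq722 hd (fun n => (g n).1.1) (fun n => (g n).2.1) (fun n => (g n).1.2)
    (fun n => (g n).2.2.2.2) ha h722
  refine ⟨KR, hKR, fun P hPd hPL k hk1 hk => ?_⟩
  obtain ⟨n, hn⟩ := hg ⟨(P, k), hPd, hPL, hk1, hk⟩
  have hbn := hb n
  rw [hn] at hbn
  exact hbn

/-! ## §5  ALL TORI: the index of `BIJ85Claim73Closed` is total at one `K_R`, and r15's `Claim73` -/

/-- **THE INDEX OF `BIJ85Claim73Closed` IS TOTAL OVER ALL TORI AT ONE `K_R`, GIVEN ONLY [6I] PROPOSITION 1.2 over the all-tori family**: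
there is ONE `K_R ≥ 1` such that EVERY actual Sect. 7.3 datum — any torus `P` with `P.d = d`, `P.L = L` (any volume exponent `m`, any number
of steps `K`), any scale `1 ≤ k ≤ m + K`, any coupling `0 < e ≤ 1` with `e𝓅(e) ≤ ½`, ANY unit-lattice `U(1)` field `v` on `T^{(k)}` — is an
index of gen-7's `ClosedIdx d K_R 𝓅`; hence `BIJ85Claim73Closed.claim73_closed` ((7.3.1) ⇒ (7.3.2) for the actual background (4.5.4), constants
`γ, α, M` functions of `(d, a₀, K_R, 𝓅)` only) speaks about all of them: the printed uniformity in `k` AND in the volume.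
[cite: BalabanImbrieJaffe1985, (7.3.1)–(7.3.2) p.326] -/
theorem closedIdx_allTori_of_prop12Printed {d L : ℕ} (hd : 2 ≤ d) {a : ℝ} (ha : 0 < a)
    (h12 : B5.Prop12Printed (fun i : {x : Params × ℕ // x.1.d = d ∧ x.1.L = L ∧ 1 ≤ x.2 ∧ x.2 ≤ x.1.m + x.1.K} =>
      settingOf (torusRep i.1.1 i.1.2 (deltaAData i.2.2.2.2 a)) i.1.2)) (pexp : ℝ) :
    ∃ KR : ℝ, 1 ≤ KR ∧ ∀ (P : Params), P.d = d → P.L = L → ∀ (k : ℕ), 1 ≤ k → k ≤ P.m + P.K →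
      ∀ (e : ℝ) (he : 0 < e) (he1 : e ≤ 1) (hsmall : e * (1 + Real.log e⁻¹) ^ pexp ≤ 1 / 2) (v : U1Field P k),
        ∃ i : ClosedIdx d KR pexp, i.P = P ∧ i.k = k ∧ i.e = e ∧ HEq i.v v := by
  obtain ⟨KR, hKR, hb⟩ := exists_KR_allTori_of_prop12Printed hd ha h12
  refine ⟨KR, hKR, fun P hPd hPL k hk1 hk e he he1 hsmall v => ?_⟩
  refine ⟨ClosedIdx.ofD₂ P hPd (hd.trans_eq hPd.symm) k hk1 hk e he he1 hsmall v ?_, rfl, rfl, rfl, HEq.rfl⟩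
  intro F hF s hs p
  have hcl : IsClosedPlaq F := by rw [altExt_eq_plaqCoch] at hF; exact hF
  rw [mul_comm (Real.sqrt _) KR]
  exact hb P hPd hPL k hk1 hk F hcl s (nonneg_of_abs_le (hd.trans_eq hPd.symm) hs) hs p

/-- **r15's `Claim73 𝓅` FOR THE ACTUAL Sect. 7.3 DATA OVER ALL TORI AT ONE `K_R`** (packaging of `closedIdx_allTori_of_prop12Printed` with
gen-7's `claim73_closed`): given [6I] Prop. 1.2 by its tree name over the all-tori family, there is ONE `K_R ≥ 1` such that (a) `Claim73 𝓅`
holds for the family `closedStabData a₀` over `ClosedIdx d K_R 𝓅` — constants `γ = min(a₀/(9(d+1)), 1/12)`, `α = ½`,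
`M = (4/3)d⁴((π/2)K_R)²(1+4𝓅₊)^{2𝓅₊}` (`a₀ > 0` the printed `a` of (4.6.4)) — and (b) that family contains EVERY actual datum over EVERY torus of
dimension `d` and block size `L`: *"For constants γ > 0, α > 0, M < ∞"* chosen before `k`, the volume and the configuration, (7.3.1) ⇒ (7.3.2).
[cite: BalabanImbrieJaffe1985, (7.3.1)–(7.3.2) p.326] -/
theorem claim73_allTori_of_prop12Printed {d L : ℕ} (hd : 2 ≤ d) {a : ℝ} (ha : 0 < a)
    (h12 : B5.Prop12Printed (fun i : {x : Params × ℕ // x.1.d = d ∧ x.1.L = L ∧ 1 ≤ x.2 ∧ x.2 ≤ x.1.m + x.1.K} =>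
      settingOf (torusRep i.1.1 i.1.2 (deltaAData i.2.2.2.2 a)) i.1.2)) (a₀ : ℝ) (ha₀ : 0 < a₀) (pexp : ℝ) :
    ∃ KR : ℝ, 1 ≤ KR ∧
      ScalarStabData.Claim73 pexp (closedStabData (d := d) (KR := KR) (pexp := pexp) a₀ ha₀) ∧
      ∀ (P : Params), P.d = d → P.L = L → ∀ (k : ℕ), 1 ≤ k → k ≤ P.m + P.K →
        ∀ (e : ℝ) (he : 0 < e) (he1 : e ≤ 1) (hsmall : e * (1 + Real.log e⁻¹) ^ pexp ≤ 1 / 2) (v : U1Field P k),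
          ∃ i : ClosedIdx d KR pexp, i.P = P ∧ i.k = k ∧ i.e = e ∧ HEq i.v v := by
  obtain ⟨KR, hKR, hb⟩ := closedIdx_allTori_of_prop12Printed hd ha h12 pexp
  exact ⟨KR, hKR, claim73_closed a₀ ha₀ KR pexp, hb⟩

/-! ## §6  ALL TORI, HYPOTHESIS-FREE (v1.1): the all-tori Prop. 1.2 is p19's `prop12Printed_allTori` -/

/-- **ONE `K_R` FOR ALL TORI, HYPOTHESIS-FREE**: for every dimension `d ≥ 2`, block size `L` and `a > 0` there is ONE `K_R ≥ 1` such that for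
EVERY torus `P` with `P.d = d`, `P.L = L` (any volume exponent `m`, any number of steps `K`), every scale `1 ≤ k ≤ m + K`, every CLOSED unit
plaquette field `f` on `T^{(k)}` with `|f| ≤ s` and every η-plaquette `p`: `|resE(f)(p)| ≤ K_R·√(η^d)·s` — §4 fed with [6I] Proposition 1.2
over all tori by its tree name, p19's `BIJ85Prop12AllTori.prop12Printed_allTori` (*"with the constant O(1) depending on d only … independent of
k, T_η"*). [cite: BalabanImbrieJaffe1985, (7.2.2) p.325, (7.3.2) p.326; Balaban1984PropagatorsI, Prop. 1.2 (1.110)–(1.114) pp.35–36] -/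
theorem exists_KR_allTori {d L : ℕ} (hd : 2 ≤ d) {a : ℝ} (ha : 0 < a) :
    ∃ KR : ℝ, 1 ≤ KR ∧ ∀ (P : Params) (hPd : P.d = d), P.L = L → ∀ (k : ℕ), 1 ≤ k → k ≤ P.m + P.K →
      ∀ (f : TPlaq P k → ℝ), IsClosedPlaq f → ∀ (s : ℝ), 0 ≤ s → (∀ q, |f q| ≤ s) → ∀ p : TPlaq P 0,
        |resE (hd.trans_eq hPd.symm) ((P.eta k) ^ P.d) (P.eta k)⁻¹ k (toU P k f) p| ≤ KR * Real.sqrt ((P.eta k) ^ P.d) * s :=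
  exists_KR_allTori_of_prop12Printed hd ha (prop12Printed_allTori d L ha)

/-- **THE INDEX OF `BIJ85Claim73Closed` IS TOTAL OVER ALL TORI AT ONE `K_R`, HYPOTHESIS-FREE**: for every `d ≥ 2`, `L`, `a > 0` and `𝓅`
there is ONE `K_R ≥ 1` such that EVERY actual Sect. 7.3 datum — any torus `P` with `P.d = d`, `P.L = L`, any scale `1 ≤ k ≤ m + K`, any
coupling `0 < e ≤ 1` with `e𝓅(e) ≤ ½`, ANY unit-lattice `U(1)` field `v` on `T^{(k)}` — is an index of gen-7's `ClosedIdx d K_R 𝓅`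
(§5 `closedIdx_allTori_of_prop12Printed` ∘ p19's `prop12Printed_allTori`). [cite: BalabanImbrieJaffe1985, (7.3.1)–(7.3.2) p.326] -/
theorem closedIdx_allTori {d L : ℕ} (hd : 2 ≤ d) {a : ℝ} (ha : 0 < a) (pexp : ℝ) :
    ∃ KR : ℝ, 1 ≤ KR ∧ ∀ (P : Params), P.d = d → P.L = L → ∀ (k : ℕ), 1 ≤ k → k ≤ P.m + P.K →
      ∀ (e : ℝ) (he : 0 < e) (he1 : e ≤ 1) (hsmall : e * (1 + Real.log e⁻¹) ^ pexp ≤ 1 / 2) (v : U1Field P k),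
        ∃ i : ClosedIdx d KR pexp, i.P = P ∧ i.k = k ∧ i.e = e ∧ HEq i.v v :=
  closedIdx_allTori_of_prop12Printed hd ha (prop12Printed_allTori d L ha) pexp

/-- **r15's `Claim73 𝓅` FOR THE ACTUAL Sect. 7.3 DATA OVER ALL TORI AT ONE `K_R`, HYPOTHESIS-FREE** — the printed *"For constants γ > 0,
α > 0, M < ∞"* chosen before the scale `k`, the volume `T_η` and the configuration, (7.3.1) ⇒ (7.3.2): for every dimension `d ≥ 2`, block
size `L`, every `a > 0` (the (7.2.2)/(1.69) mass parameter feeding `K_R`), every `a₀ > 0` (the printed `a` of (4.6.4)) and every exponent `𝓅`,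
there is ONE `K_R ≥ 1` such that (a) `ScalarStabData.Claim73 𝓅` holds for gen-7's family `closedStabData a₀` over `ClosedIdx d K_R 𝓅` —
constants `γ = min(a₀/(9(d+1)), 1/12)`, `α = ½`, `M = (4/3)d⁴((π/2)K_R)²(1+4𝓅₊)^{2𝓅₊}` — and (b) that family contains EVERY actual datum
(any torus `P` with `P.d = d`, `P.L = L`, any scale `1 ≤ k ≤ m + K`, any `0 < e ≤ 1` with `e𝓅(e) ≤ ½`, any unit field `v`).  §5
`claim73_allTori_of_prop12Printed` with its only hypothesis, [6I] Prop. 1.2 over all tori, supplied by p19's `prop12Printed_allTori`.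
HONEST SCOPE as in the header: first printed form of (7.3.2), CLOSED unit fields, `U = 1` real abelian fields, torus, `k ≤ m + K`, `2 ≤ d`,
constants explicit and not optimised; nothing here is summit progress. [cite: BalabanImbrieJaffe1985, (7.3.1)–(7.3.2) p.326] -/
theorem claim73_allTori {d L : ℕ} (hd : 2 ≤ d) {a : ℝ} (ha : 0 < a) (a₀ : ℝ) (ha₀ : 0 < a₀) (pexp : ℝ) :
    ∃ KR : ℝ, 1 ≤ KR ∧
      ScalarStabData.Claim73 pexp (closedStabData (d := d) (KR := KR) (pexp := pexp) a₀ ha₀) ∧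
      ∀ (P : Params), P.d = d → P.L = L → ∀ (k : ℕ), 1 ≤ k → k ≤ P.m + P.K →
        ∀ (e : ℝ) (he : 0 < e) (he1 : e ≤ 1) (hsmall : e * (1 + Real.log e⁻¹) ^ pexp ≤ 1 / 2) (v : U1Field P k),
          ∃ i : ClosedIdx d KR pexp, i.P = P ∧ i.k = k ∧ i.e = e ∧ HEq i.v v :=
  claim73_allTori_of_prop12Printed hd ha (prop12Printed_allTori d L ha) a₀ ha₀ pexp

/-- **(7.3.2) AT EVERY ACTUAL DATUM OF EVERY TORUS, SAME CONSTANTS** (pointwise unpacking of `claim73_allTori`): for every torus `P` of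
dimension `d ≥ 2`, every scale `1 ≤ k ≤ m + K`, every `0 < e ≤ 1` with `e𝓅(e) ≤ ½` and every unit field `v` there is an index
`i : ClosedIdx P.d K_R 𝓅` carrying exactly `(P, k, e, v)` at the ONE `K_R = K_R(P.d, P.L, a)` of `claim73_allTori`, and `Claim73 𝓅` holds for
the family it belongs to. [cite: BalabanImbrieJaffe1985, (7.3.1)–(7.3.2) p.326] -/
theorem claim73_actual (P : Params) (hd : 2 ≤ P.d) {a : ℝ} (ha : 0 < a) (a₀ : ℝ) (ha₀ : 0 < a₀) (pexp : ℝ) :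
    ∃ KR : ℝ, 1 ≤ KR ∧
      ScalarStabData.Claim73 pexp (closedStabData (d := P.d) (KR := KR) (pexp := pexp) a₀ ha₀) ∧
      ∀ (k : ℕ), 1 ≤ k → k ≤ P.m + P.K →
        ∀ (e : ℝ) (he : 0 < e) (he1 : e ≤ 1) (hsmall : e * (1 + Real.log e⁻¹) ^ pexp ≤ 1 / 2) (v : U1Field P k),
          ∃ i : ClosedIdx P.d KR pexp, i.P = P ∧ i.k = k ∧ i.e = e ∧ HEq i.v v := by
  obtain ⟨KR, hKR, h73, hall⟩ := claim73_allTori (L := P.L) hd ha a₀ ha₀ pexp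
  exact ⟨KR, hKR, h73, fun k hk1 hk e he he1 hsmall v => hall P rfl rfl k hk1 hk e he he1 hsmall v⟩

end

end Literature.MathematicalPhysics.QuantumFieldTheory.BalabanImbrieJaffe1984to88.BIJ85Claim73AllTori
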